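import Summits.QuantumFields.YangMills.Theorems.BalabanUVNodesN12ChartBRestrict
import Summits.QuantumFields.YangMills.Theorems.BalabanUVNodesN12DirectSurjHullCountUniformB
import Summits.QuantumFields.YangMills.Theorems.BalabanUVNodesN12DirectSurjHsurjProxiesPrelim
import HarnessLib

/-!
# BalabanUVNodes ∕ N12 — THE HULL-COUNT RIGHT-INVERSE SOCKET AT PRINT's DATUM `lamBondsSeq (maxDomT M₁ Z) k` ([II] (2.3)), BY RESTRICTION from the (b)-datum socket
# `…N12DirectSurjHullCountUniformB.exists_rightInverse_hrow_uniformB` (`Bj M₁ Z k = genSet (maxDomT M₁ Z) k`) through this seat's `…N12ChartBRestrict` brick — the first (R)-adapter of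
# the (ii) split (dag-n12-d g32 ∕ dag-n12-w6 g24, pub-ymgap INBOX 2026-08-30)

[Balaban1984PropagatorsII] = «[II]», (2.3) p. 224 (print's `Λ_j` as the DIFFERENCE of the bond sets: fewer constrained bonds than reading (b)); [Balaban1985Variational] = «[15]», Sect. C
(44)–(48) p. 285, (82)–(83) p. 290, Prop. 1 p. 194 of [Balaban1989LargeFieldII] («[IV]») being the consumer; [Balaban1988Convergent] = «[III]», (2.2) p. 255, (2.10)–(2.13) pp. 256–257.

Cell `pub-ymgap` (HUMAN RULINGS D-0062 ∕ D-0149), WIDTH SEAT `pub-ymgap-dag-n12-w6` g24 (node N12 = [B15]; key K1⁹ `stmt-QuantumFields-27364`, `--kind proof --supports … --as helper`;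
count-neutral).  THEOREMS ONLY (0 `def`, 0 `instance`, 0 `sorry`); two `exact`s BY NAME: this seat's g9 `…DirectSurjHullCountUniformB.exists_rightInverse_hrow_uniformB` (the (b)-datum socket:
∃ ε ∃ B₁ per height, ∀ instance, (b)-fibre base point + tower ∕ site proxies + plaquette letter ⟹ right inverse with ℓ¹→sup, ℓ¹→ℓ¹ and per-row `hrow` letters), g7's ρ5c
`…DirectSurjHsurjProxiesPrelim.differentiableAt_msChart_of_towerProxies` (the (b)-chart is differentiable at the base point from the SAME proxies), and g24's
`…N12ChartBRestrict.exists_rightInverse_l1_hrow_of_le` (transfer along `lamBondsSeq ≤ bondsDet (genSet …)`, F0a `lamBondsSeq_subset_bondsDet`).  Imports green (no `Record13*`).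

WHY.  dag-n12-d's (ii) re-key of N12's direct road at print's datum keys its junction (v10.1 lineage) on the hull-count socket; at print's datum the socket must deliver a right inverse of
the derivative of `msChartB … (lamBondsSeq (maxDomT M₁ Z) k) W U₀` — the chart over [II] (2.3)'s bonds — with the same letters over PRINT rows.  Since every print row IS a (b)-row of
the same bond (`msChartB_apply`), and the direct road's base point lies on the (b)-fibre (`AgreeOn (Bj M₁ Z k) (M˙U₀) W`, [15] (13) at distance 0) where the (b)-chart is differentiable,
the (b)-socket's `H` restricted along the row map IS the print socket — no re-proof of the back-substitution (⚑ LOCATED-RESTRICT).  The HYPOTHESES stay in (b)-currency verbatim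
(they are properties of the base point and of the data, not of the constraint set); only the CONCLUSION moves to print's rows.

CONTENTS (namespace `Summit.QuantumFields.YangMills.BalabanUVNodes.N12ChartBRestrictHullCount`): ★★★ `exists_rightInverse_hrow_uniformB_lamBondsSeq` (= `exists_rightInverse_hrow_uniformB`
binder-for-binder with the conclusion's `msChart … (Bj M₁ Z k)` ↦ `msChartB … (lamBondsSeq (maxDomT M₁ Z) k)` and `constrCard∕constrEnum (Bj M₁ Z k)` ↦ `constrCardB∕constrEnumB (lamBondsSeq
(maxDomT M₁ Z) k)`; SAME ε, SAME B₁), ★★ `exists_rightInverse_hrow_lamBondsSeq_of_genSet` (the per-instance transfer for ANY sequence `Ω`, hypotheses = a (b)-right-inverse with the three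
letters + differentiability of the (b)-chart).

HONEST FRAMING.  A transfer by name (linear algebra over landed kernel theorems); per-height EXISTENCE letters (volume-dependent `B₁`, print's (46) NOT claimed); nothing about existence ∕
minimality over print's larger class (FLAG №16's content untouched); nothing of Bałaban's estimates asserted or refuted; count-neutral helper; N12 NOT discharged; K0⁷∕K1⁹ NOT closed;
counts of record unmoved; one finite 𝕋⁴ programme at fixed ε — R4 closes the conditional rung `BalabanLadder.UV` only; the Yang–Mills mass gap (Clay) is NOT proved by any of this; nothing
continuum ∕ ℝ⁴ ∕ OS.
-/

open scoped BigOperators Matrix.Norms.L2Operator Topology NNReal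

namespace Summit.QuantumFields.YangMills.BalabanUVNodes.N12ChartBRestrictHullCount

open Literature.MathematicalPhysics.QuantumFieldTheory.Balaban1983to89
open Node00 B15DeterminingSets B15DeterminingSetsB
open T4Continuum (T4Family)
open T4AdjointCovarianceUnitary (lieSU)
open B14.Eq213DetSet (Bj maxDomT)
open B14.Eq213MaximalDomains (side)
open B14.Eq216Concrete (feeds)
open B5Eq118OneStroke (iterBlockOf)
open B15Eq112TorusCover (lift)
open T4AxialGaugeSmallField (boxPlaqs)
open Summit.QuantumFields.YangMills.BalabanUVNodes.N12DirectSurjHullCountUniformB (exists_rightInverse_hrow_uniformB)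
open Summit.QuantumFields.YangMills.BalabanUVNodes.N12DirectSurjHsurjProxiesPrelim (differentiableAt_msChart_of_towerProxies)
open Summit.QuantumFields.YangMills.BalabanUVNodes.N12ChartBRestrict (exists_rightInverse_l1_hrow_of_le)

variable {F : T4Family} {N : ℕ} [NeZero N] {K k : ℕ}

/-- ★★ **PER-INSTANCE TRANSFER OF THE HULL-COUNT CURRENCY TO PRINT's ROWS, ANY SEQUENCE `Ω`**: at a base point where the (b)-chart `msChart … (genSet Ω k) W U₀` is differentiable at `0`, a
right inverse of its derivative with the ℓ¹→sup letter `‖H v‖ ≤ B₁Σ‖v i‖`, the ℓ¹→ℓ¹ letter `Σ_b‖H v b‖ ≤ B₁Σ‖v i‖` and the per-row `hrow` letter (every row of level `≥ 1` has a preimage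
of `Pi.single i ξ` with `Σ_b‖↑x_b‖ ≤ B₁‖ξ‖`) yields the same three letters for `msChartB … (lamBondsSeq Ω k) W U₀` over PRINT's rows (`constrEnumB (lamBondsSeq Ω k) k`).
[cite: Balaban1984PropagatorsII, (2.3) p.224; Balaban1985Variational, Sect. C (44)–(48) p.285; Balaban1988Convergent, (2.10)–(2.12) p.256] -/
theorem exists_rightInverse_hrow_lamBondsSeq_of_genSet {Ω : ℕ → Set (Site (F.P K) 0)} {W : MSField (F.P K) (SU N)} {U₀ : GaugeField (F.P K) 0 (SU N)}
    (hd : DifferentiableAt ℝ (msChart F N K k (genSet Ω k) W U₀) 0) {B₁ : ℝ}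
    {H : (Fin (constrCard (genSet Ω k) k) → lieSU (Fin N)) → PBond (F.P K) 0 → lieSU (Fin N)}
    (hH : ∀ v, fderiv ℝ (msChart F N K k (genSet Ω k) W U₀) 0 (H v) = v) (hHB : ∀ v, ‖H v‖ ≤ B₁ * ∑ i, ‖v i‖)
    (hHB1 : ∀ v, ∑ b, ‖H v b‖ ≤ B₁ * ∑ i, ‖v i‖)
    (hrow : ∀ i : Fin (constrCard (genSet Ω k) k), 1 ≤ ((((constrEnum (genSet Ω k) k).symm i).1 : ℕ)) → ∀ ξ : lieSU (Fin N),
      ∃ x : PBond (F.P K) 0 → lieSU (Fin N), fderiv ℝ (msChart F N K k (genSet Ω k) W U₀) 0 x = Pi.single i ξ ∧ ∑ b, ‖(x b : Matrix (Fin N) (Fin N) ℂ)‖ ≤ B₁ * ‖ξ‖) :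
    ∃ H' : (Fin (constrCardB (lamBondsSeq Ω k) k) → lieSU (Fin N)) → PBond (F.P K) 0 → lieSU (Fin N),
      (∀ v, fderiv ℝ (msChartB F N K k (lamBondsSeq Ω k) W U₀) 0 (H' v) = v) ∧ (∀ v, ‖H' v‖ ≤ B₁ * ∑ i, ‖v i‖) ∧ (∀ v, ∑ b, ‖H' v b‖ ≤ B₁ * ∑ i, ‖v i‖) ∧
      ∀ i : Fin (constrCardB (lamBondsSeq Ω k) k), 1 ≤ ((((constrEnumB (lamBondsSeq Ω k) k).symm i).1 : ℕ)) → ∀ ξ : lieSU (Fin N),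
        ∃ x : PBond (F.P K) 0 → lieSU (Fin N), fderiv ℝ (msChartB F N K k (lamBondsSeq Ω k) W U₀) 0 x = Pi.single i ξ ∧ ∑ b, ‖(x b : Matrix (Fin N) (Fin N) ℂ)‖ ≤ B₁ * ‖ξ‖ :=
  exists_rightInverse_l1_hrow_of_le (𝔅' := bondsDet (genSet Ω k)) (lamBondsSeq_subset_bondsDet Ω k) hd hH hHB hHB1 hrow

/-- ★★★ **THE HULL-COUNT RIGHT-INVERSE SOCKET AT PRINT's DATUM** — `…DirectSurjHullCountUniformB.exists_rightInverse_hrow_uniformB` binder-for-binder (∃ ε ∃ B₁ per height; per instance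
`M₁ ≥ 1`, `Z`, `hdiv`, `W`, `U₀`, the (b)-fibre base point `AgreeOn (Bj M₁ Z k) (M˙U₀) W`, the tower proxies per (b)-row, the site proxies, the box-plaquette letter at `ε`) with the
CONCLUSION over PRINT's chart `msChartB … (lamBondsSeq (maxDomT M₁ Z) k) W U₀` and print's rows: right inverse, `‖H v‖ ≤ B₁Σ‖v i‖`, `Σ_b‖H v b‖ ≤ B₁Σ‖v i‖`, and the per-row `hrow` letter at
every print row of level `≥ 1`.  SAME `ε`, SAME `B₁` as the (b)-socket.  Proof: the (b)-socket's `H` (g9) restricted along the row map (g24 brick); differentiability of the (b)-chart at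
the base point from the tower proxies (g7 ρ5c); `Bj M₁ Z k = genSet (maxDomT M₁ Z) k` and `msChart = msChartB ∘ bondsDet` are `rfl`.
[cite: Balaban1984PropagatorsII, (2.3) p.224; Balaban1985Variational, Sect. C (44)–(48) p.285, (82)–(83) p.290; Balaban1988Convergent, (2.2) p.255, (2.10)–(2.13) pp.256–257; Balaban1989LargeFieldII, Prop. 1 p.194] -/
theorem exists_rightInverse_hrow_uniformB_lamBondsSeq (hkK : k + 1 ≤ (F.P K).m + (F.P K).K) :
    ∃ ε : ℝ, 0 < ε ∧ ∃ B₁ : ℝ, 0 ≤ B₁ ∧ ∀ (M₁ : ℕ) (_ : 1 ≤ M₁) (Z : Set (Site (F.P K) 0)) (_ : side (F.P K).L M₁ k ∣ (F.P K).sitesPerDir 0)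
      (W : MSField (F.P K) (SU N)) (U₀ : GaugeField (F.P K) 0 (SU N)),
        AgreeOn (Bj M₁ Z k) (avgFamily (avOfRecord F N K) U₀) W →
        (∀ i : Fin (constrCard (Bj M₁ Z k) k), ∃ U' : GaugeField (F.P K) 0 (SU N),
          (∀ b ∈ feeds (((constrEnum (Bj M₁ Z k) k).symm i).1 : ℕ) ((constrEnum (Bj M₁ Z k) k).symm i).2.1, U' b = U₀ b) ∧ SmallBelow (avOfRecord F N K) k U') →
        (∀ (j : ℕ), 1 ≤ j → j ≤ k → ∀ y : Site (F.P K) j, embIter j y ∈ maxDomT M₁ Z j → ∃ U' : GaugeField (F.P K) 0 (SU N),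
          (∀ c : PBond (F.P K) j, (c.src = y ∨ c.tgt = y) → ∀ b₀ : PBond (F.P K) 0,
            (iterBlockOf j b₀.src = c.src ∨ iterBlockOf j b₀.src = c.tgt) → (iterBlockOf j b₀.tgt = c.src ∨ iterBlockOf j b₀.tgt = c.tgt) → U' b₀ = U₀ b₀) ∧
          SmallBelow (avOfRecord F N K) k U') →
        (∀ (j : ℕ), 1 ≤ j → j ≤ k → ∀ y : Site (F.P K) j, embIter j y ∈ maxDomT M₁ Z j →
          PlaqSmallOn (boxPlaqs (P := F.P K) (j := 0)
            (fun κ => lift (F.P K) (embIter j y) κ - ((((F.P K).L ^ j : ℕ) : ℤ) + ((((F.P K).L ^ j - 1) / 2 : ℕ) : ℤ)))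
            (fun κ => lift (F.P K) (embIter j y) κ + ((((F.P K).L ^ j : ℕ) : ℤ) + ((((F.P K).L ^ j - 1) / 2 : ℕ) : ℤ)))) ε U₀) →
        ∃ H : (Fin (constrCardB (lamBondsSeq (maxDomT M₁ Z) k) k) → lieSU (Fin N)) → PBond (F.P K) 0 → lieSU (Fin N),
          (∀ v, fderiv ℝ (msChartB F N K k (lamBondsSeq (maxDomT M₁ Z) k) W U₀) 0 (H v) = v) ∧
          (∀ v, ‖H v‖ ≤ B₁ * ∑ i, ‖v i‖) ∧
          (∀ v, ∑ b, ‖H v b‖ ≤ B₁ * ∑ i, ‖v i‖) ∧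
          ∀ i : Fin (constrCardB (lamBondsSeq (maxDomT M₁ Z) k) k), 1 ≤ ((((constrEnumB (lamBondsSeq (maxDomT M₁ Z) k) k).symm i).1 : ℕ)) → ∀ ξ : lieSU (Fin N),
            ∃ x : PBond (F.P K) 0 → lieSU (Fin N), fderiv ℝ (msChartB F N K k (lamBondsSeq (maxDomT M₁ Z) k) W U₀) 0 x = Pi.single i ξ ∧
              ∑ b, ‖(x b : Matrix (Fin N) (Fin N) ℂ)‖ ≤ B₁ * ‖ξ‖ := by
  obtain ⟨ε, hε, B₁, hB₁, h⟩ := exists_rightInverse_hrow_uniformB (F := F) (N := N) (K := K) (k := k) hkK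
  refine ⟨ε, hε, B₁, hB₁, fun M₁ hM₁ Z hdiv W U₀ hU hprox hproxSite hplaq => ?_⟩
  obtain ⟨H, hH, hHB, hHB1, hrow⟩ := h M₁ hM₁ Z hdiv W U₀ hU hprox hproxSite hplaq
  have hd : DifferentiableAt ℝ (msChart F N K k (Bj M₁ Z k) W U₀) 0 :=
    differentiableAt_msChart_of_towerProxies (Nat.le_of_succ_le hkK) hU hprox
  exact exists_rightInverse_hrow_lamBondsSeq_of_genSet (Ω := maxDomT M₁ Z) hd hH hHB hHB1 hrow

end Summit.QuantumFields.YangMills.BalabanUVNodes.N12ChartBRestrictHullCount
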